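import Summits.HodgeConjecture.HodgeConjecture.Theorems.H413FinCoeffNonvanishingFamily
import Literature.NumberTheory.GelbartRogawski1991.UnitaryDualPairWeilCoinvariantsTwist
import Literature.NumberTheory.GelbartRogawski1991.UnitaryDualPairWeilCoinvariantsReference
import Literature.MeasureTheory.Group.QuotientAveraging
import HarnessLib

/-!
# H413 ∕ S4b (FIN) — the `hfin` ROW AT AN ARBITRARY COMPATIBLE SPLITTING (the pin's `splittingOf hGR₀` included)

Crux H413 (stmt-HodgeConjecture-24833), line `F0_P4AdmissibleOccursInH1`, stub S4b, row `hfin` of ★ brick 7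
`UnitaryDualPair.thetaLift_charCM_tmul_ne_zero_of_finCoeff_ne_zero` (`Li1992/ThetaLiftCharacterArchFinReduction`) ∕ ★
`ThetaNonvanishing.dist_ne_zero_of_rallis_of_eigen_of_finCoeff` — the ONE non-zero finite Fourier coefficient
`∫_{U(J₁)(𝔸_{F,f})} ⟨R_e ω_f^{s}(1,b) R_e⁻¹ Φ_f, Φ_f⟩_μ · \overline{χ_f(b)} dμ_f(b) ≠ 0` for the finite Weil representation `ω_f^{s}` (★
`WeilCoinv.finPairRep`) of the CONSUMER's compatible splitting `s` — at the pin `s = splittingOf hGR₀`, an abstract witness of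
[GelbartRogawski1991, Prop. 3.1.1] about which nothing but compatibility and continuity is known.

THE POINT ([GelbartRogawski1991, §3.1 Remark p. 457 L4–13]; [Liu2021, App. D §D.1]): two compatible splittings differ by an AUTOMORPHIC
character, `sref = s ⊗ ĉ` with `ĉ = 1` on `G₁(F)` (★ `exists_eq_twist_of_isCompatible`), and the finite Weil representation only picks up the
scalar `ĉ(1 ⊗ (1,b))` (★ `finPairRep_twist`): `ω_f^{sref}(1,b) = twistCharW ĉ b • ω_f^{s}(1,b)`.  On `U(J₁)` — a hermitian LINE, `[U(J₁)]`
compact — the character `b ↦ ĉ(1 ⊗ b)` is UNITARY (`norm_eq_one_of_forall_range_eq_one`: a continuous character trivial on a cocompact subgroup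
has bounded, hence unit-modulus, image).  So the weight `\overline{χ_f}` against `ω_f^{s}` is the weight `\overline{twistCharW ĉ · χ_f}` against
the REFERENCE representation `ω_f^{sref}`, which for the `χ`-attached splitting of the line is the place-assembled `Ω = ⊗'_v ω_v` of a CM local
family `𝓢` (★ `finPairRep_chiSplittingLine_apply`, taken here as the hypothesis `href`), and the (FIN) capstone ★
`exists_finCoeff_ne_zero_of_localSplittings` (p797998) applies with `χ₁ := (twistCharW ĉ · χ_f) ∘ (u ↦ u·1₁)`.

* `norm_eq_one_of_forall_range_eq_one` — unitarity of automorphic characters of `U(J)(𝔸_F)` when `[U(J)]` is compact;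
* **`exists_finCoeff_ne_zero_of_compatible`** — THE ROW: for every continuous unitary `χ_f : U(J₁)(𝔸_{F,f}) →* ℂˣ` there is `Φ_f ∈ 𝒮(𝔸_{F,f}ⁿ)`
  with `∫ b, (∫ y, (R_e (ω_f^{s}(1,b) (R_e⁻¹ Φ_f))) y · conj (Φ_f y) ∂μ) · conj (χ_f b) ∂μ_f ≠ 0`.

KERNEL: theorems only, DEF-FREE, no `sorry`.  HC_CM is proved only modulo the printed citations until rung 0 closes.

[cite: Li1992, Thm 2.1 (27) p. 184; §5 p. 206] [cite: GelbartRogawski1991, §3.1 Prop. 3.1.1 p. 455 and Remark p. 457 L4–13]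
[cite: Liu2021, App. D §D.1 Steps 1–3 (l. 5214–5233)]
-/

set_option autoImplicit false
set_option linter.dupNamespace false

noncomputable section

open scoped RestrictedProduct ENNReal NNReal ComplexConjugate Matrix Kronecker
open MeasureTheory NumberField IsDedekindDomain Filter Function Set Topology
open Literature.NumberTheory.Automorphic Literature.NumberTheory.Automorphic.UnitaryGroup
open Literature.NumberTheory.Weil1964
open Literature.NumberTheory.GelbartRogawski1991 Literature.NumberTheory.GelbartRogawski1991.UnitaryDualPair
open Literature.NumberTheory.GelbartRogawski1991.UnitaryDualPair.WeilCoinv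
open Literature.NumberTheory.GelbartRogawski1991.UnitaryDualPair.LocalSplitting
open HodgeCM.PerL34 HodgeCM.PerL34.RestrictedMeasure HodgeCM.PerL34.PureTensor HodgeCM.PerL34.NoSmallSubgroups

namespace Summit.HodgeConjecture.HodgeConjecture.Cruxes.H413.ThetaNonvanishing

/-! ## §1 Automorphic characters of a compact adelic quotient are unitary -/

section Unitary

variable {G : Type*} [Group G] [TopologicalSpace G] [IsTopologicalGroup G] [LocallyCompactSpace G]
  (Γ : Subgroup G) [CompactSpace (G ⧸ Γ)]

/-- **A continuous character trivial on a cocompact subgroup is unitary**: if `φ : G →* ℂˣ` is continuous, `φ = 1` on `Γ` and `G ⧸ Γ` is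
compact, then `‖φ g‖ = 1` for all `g` — `φ(G) = φ(K)` for a compact `K` with `KΓ = G` (★ `WeilQuotient.exists_isCompact_image_mk_superset`), a
bounded subgroup of `ℂˣ`, and a bounded subgroup of `ℂˣ` lies on the unit circle (its powers and inverses stay bounded).
[cite: GelbartRogawski1991, §3.1 Remark p. 457 L4–13] -/
theorem norm_eq_one_of_forall_range_eq_one (φ : G →* ℂˣ) (hφ : Continuous fun g => ((φ g : ℂˣ) : ℂ))
    (hΓ : ∀ γ ∈ Γ, φ γ = 1) (g : G) : ‖((φ g : ℂˣ) : ℂ)‖ = 1 := by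
  -- a compact `K ⊆ G` meeting every coset
  obtain ⟨K, hK, hcov⟩ := Literature.MeasureTheory.Group.WeilQuotient.exists_isCompact_image_mk_superset (H := Γ)
    (isCompact_univ : IsCompact (univ : Set (G ⧸ Γ)))
  -- the norm of `φ` is bounded on `K`, hence on `G`
  obtain ⟨B, hB⟩ : ∃ B : ℝ, ∀ k ∈ K, ‖((φ k : ℂˣ) : ℂ)‖ ≤ B := hK.exists_bound_of_continuousOn hφ.continuousOn
  have hbound : ∀ x : G, ‖((φ x : ℂˣ) : ℂ)‖ ≤ B := fun x => by
    obtain ⟨k, hk, hkx⟩ := hcov (mem_univ (QuotientGroup.mk x : G ⧸ Γ))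
    rw [QuotientGroup.eq] at hkx
    have hx : x = k * (k⁻¹ * x) := by rw [mul_inv_cancel_left]
    rw [hx, map_mul, hΓ _ hkx, mul_one]
    exact hB k hk
  -- a bounded subgroup of `ℂˣ` lies on the unit circle
  have hle : ∀ x : G, ‖((φ x : ℂˣ) : ℂ)‖ ≤ 1 := fun x => by
    by_contra h
    -- the powers `‖φ (x^m)‖ = ‖φ x‖^m` are unbounded
    obtain ⟨m, hm⟩ := pow_unbounded_of_one_lt B (not_le.1 h)
    have := hbound (x ^ m)
    rw [map_pow, Units.val_pow_eq_pow_val, norm_pow] at this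
    exact absurd (hm.trans_le this) (lt_irrefl _)
  refine le_antisymm (hle g) ?_
  -- `‖φ g‖ ≥ 1` from `‖φ g⁻¹‖ ≤ 1` and `φ g · φ g⁻¹ = 1`
  have hinv := hle g⁻¹
  rw [map_inv, Units.val_inv_eq_inv_val, norm_inv] at hinv
  have hpos : 0 < ‖((φ g : ℂˣ) : ℂ)‖ := norm_pos_iff.2 (Units.ne_zero _)
  exact (inv_le_one₀ hpos).1 hinv

end Unitary

/-! ## §2 The `hfin` row at an arbitrary compatible splitting -/

section AtSplitting

variable (F E : Type) [Field F] [NumberField F] [Field E] [NumberField E] [Algebra F E]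
  [Algebra.IsQuadraticExtension F E] (c : E ≃ₐ[F] E) (N : ℕ) {n : ℕ} (e : Fin N × Fin 1 ≃ Fin n)
  (JV : Matrix (Fin N) (Fin N) E) (J₁ : Matrix (Fin 1) (Fin 1) E) (hJ₁ : J₁ 0 0 ≠ 0)
  {δ : E} (hcδ : c δ = -δ) (hδ : δ ≠ 0) {d : F} (hd : δ * δ = algebraMap F E d)
  (Tb : Matrix (Fin n) (Fin n) F) (hTb : Tb.IsSymm) (hJb : Matrix.reindex e e (JV ⊗ₖ J₁) = Tb.map (algebraMap F E))
  (𝓢 : FinLocalSplittings F E c n hcδ hδ hd Tb hTb hJb) (hTd : IsUnit Tb.det) (h3 : 3 ≤ n) (hJ₁c : (J₁.map c)ᵀ = J₁)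
  [MeasurableSpace (FiniteAdeleRing (𝓞 F) F)] [BorelSpace (FiniteAdeleRing (𝓞 F) F)]
  [∀ v : HeightOneSpectrum (𝓞 F), MeasurableSpace (v.adicCompletion F)]
  [∀ v : HeightOneSpectrum (𝓞 F), BorelSpace (v.adicCompletion F)]
  (μ' : ∀ v : HeightOneSpectrum (𝓞 F), Measure (v.adicCompletion F)) [∀ v, (μ' v).IsAddHaarMeasure]
  (hL2 : ∀ v : HeightOneSpectrum (𝓞 F), (𝓢.omegaLoc v).IsL2Isometric (Measure.pi fun _ : Fin n => μ' v))
  (μ : Measure (Fin n → FiniteAdeleRing (𝓞 F) F)) [μ.IsAddHaarMeasure]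
  [∀ v : HeightOneSpectrum (𝓞 F), MeasurableSpace (localPi E c 1 J₁ v)]
  [∀ v : HeightOneSpectrum (𝓞 F), BorelSpace (localPi E c 1 J₁ v)]
  [MeasurableSpace (finAdelic F E c 1 J₁)] [BorelSpace (finAdelic F E c 1 J₁)]
  (μf : Measure (finAdelic F E c 1 J₁)) [μf.IsHaarMeasure]
  (νW : ∀ v : HeightOneSpectrum (𝓞 F), Measure (localPi E c 1 J₁ v)) [∀ v, (νW v).IsHaarMeasure] [∀ v, SigmaFinite (νW v)]
  (S₀ : Finset (HeightOneSpectrum (𝓞 F))) {i₀ : HeightOneSpectrum (𝓞 F)} (hi₀ : i₀ ∈ S₀)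
  (hB1 : ∀ v, v ∉ S₀ → νW v (localInt E c 1 J₁ v : Set (localPi E c 1 J₁ v)) = 1)
  -- the dual pair's splitting datum over `F`
  {TV : Matrix (Fin N) (Fin N) F} {TW : Matrix (Fin 1) (Fin 1) F}
  (hV : TV.IsSymm) (hW : TW.IsSymm) (hVd : IsUnit TV.det) (hWd : IsUnit TW.det)
  (hJV : JV = TV.map (algebraMap F E)) (hJW : J₁ = TW.map (algebraMap F E))
  [CompactSpace (adelic F E c 1 J₁ ⧸ (toAdelic F E c 1 J₁).range)]
  {s sref : adelicPair F E c N 1 JV J₁ →* adelicMpCont F (Fin n) (adelicGram F e TV TW)}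
  (hs : (splittingDatum F E c N 1 e JV J₁ hcδ hδ hd hV hW hVd hWd hJV hJW).IsCompatible s)
  (hsref : (splittingDatum F E c N 1 e JV J₁ hcδ hδ hd hV hW hVd hWd hJV hJW).IsCompatible sref)
  (hsc : Continuous s) (hsrefc : Continuous sref)
  (href : ∀ (b : finAdelic F E c 1 J₁) (f : FinSB F (Fin N × Fin 1)),
    finPairRep F E c N 1 e JV J₁ hcδ hδ hd hV hW hVd hWd hJV hJW hsref (1, b) f =
      (finSBReindex F e).symm (𝓢.Omega (finPairEmb F E c N 1 e JV J₁ (1, b)) (finSBReindex F e f)))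
  (χf : finAdelic F E c 1 J₁ →* ℂˣ) (hχf : Continuous fun b => ((χf b : ℂˣ) : ℂ)) (hχfu : ∀ b, ‖((χf b : ℂˣ) : ℂ)‖ = 1)

set_option maxHeartbeats 2000000 in
include hJ₁ hTd h3 hJ₁c hL2 hi₀ hB1 hsc hsrefc href hχf hχfu in
/-- **(FIN) AT AN ARBITRARY COMPATIBLE SPLITTING — the `hfin` row.**  For the consumer's compatible continuous splitting `s` of the dual pair
`(U(J_V), U(J₁))` (`J₁` a hermitian line, `n = N·1 ≥ 3`), a reference compatible continuous splitting `sref` whose finite Weil representation on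
`1 × U(J₁)(𝔸_{F,f})` is the place-assembled `Ω` of a restricted family `𝓢` of local splittings with `L²`-isometric local Weil representations
(`href`; at the `χ`-line this is ★ `finPairRep_chiSplittingLine_apply`), `[U(J₁)]` compact, and ANY continuous unitary character `χ_f` of
`U(J₁)(𝔸_{F,f})`: THERE IS `Φ_f ∈ 𝒮(𝔸_{F,f}ⁿ)` with `∫_{U(J₁)(𝔸_f)} ⟨R_e ω_f^{s}(1,b) R_e⁻¹ Φ_f, Φ_f⟩_μ \overline{χ_f(b)} dμ_f(b) ≠ 0` — the `hfin`
binder of ★ `thetaLift_charCM_tmul_ne_zero_of_finCoeff_ne_zero` with `ωfin b := R_e ∘ ω_f^{s}(1,b) ∘ R_e⁻¹`, `Ψfin := Φfin`, `wfin := conj ∘ χ_f`.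
Proof: `sref = s ⊗ ĉ` (★ `exists_eq_twist_of_isCompatible`), `ω_f^{sref}(1,b) = twistCharW ĉ b • ω_f^{s}(1,b)` (★ `finPairRep_twist`),
`‖twistCharW ĉ b‖ = 1` (§1), so the weight against `Ω` is `\overline{(twistCharW ĉ · χ_f)(b)}` and ★ `exists_finCoeff_ne_zero_of_localSplittings`
applies with `χ₁ := (twistCharW ĉ · χ_f) ∘ finAdelicCenter`. [cite: Li1992, Thm 2.1 (27) p. 184; §5 p. 206]
[cite: GelbartRogawski1991, §3.1 Remark p. 457 L4–13] [cite: Liu2021, App. D §D.1 Steps 1–3 (l. 5214–5233)] -/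
theorem exists_finCoeff_ne_zero_of_compatible :
    ∃ Φf : FinSB F (Fin n),
      ∫ b, (∫ y, ((finSBReindex F e (finPairRep F E c N 1 e JV J₁ hcδ hδ hd hV hW hVd hWd hJV hJW hs (1, b)
              ((finSBReindex F e).symm Φf)) : ↥(SchwartzBruhat (Fin n → FiniteAdeleRing (𝓞 F) F))) :
              (Fin n → FiniteAdeleRing (𝓞 F) F) → ℂ) y *
          conj (((Φf : ↥(SchwartzBruhat (Fin n → FiniteAdeleRing (𝓞 F) F))) : (Fin n → FiniteAdeleRing (𝓞 F) F) → ℂ) y) ∂μ) *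
        conj (((χf b : ℂˣ) : ℂ)) ∂μf ≠ 0 := by
  classical
  -- the two splittings differ by an automorphic character `ĉ`
  obtain ⟨ĉ, hĉ, hĉrat, hĉc⟩ := exists_eq_twist_of_isCompatible F E c N 1 e JV J₁ hcδ hδ hd hV hW hVd hWd hJV hJW hs hsref
  have hĉc' : Continuous ĉ := hĉc hsc hsrefc
  subst hĉ
  -- the finite `U(J₁)`-part `tw := twistCharW ĉ` is a continuous unitary character
  set tw : finAdelic F E c 1 J₁ →* ℂˣ := twistCharW F E c N 1 JV J₁ ĉ with htw
  have htwc : Continuous fun b => ((tw b : ℂˣ) : ℂ) := by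
    refine Units.continuous_val.comp ?_
    exact hĉc'.comp ((continuous_adelicInr F E c N 1 JV J₁).comp (continuous_finAdelicToAdelic F E c 1 J₁))
  have htwu : ∀ b, ‖((tw b : ℂˣ) : ℂ)‖ = 1 := fun b => by
    -- `u ↦ ĉ(1 ⊗ u)` on `U(J₁)(𝔸_F)` is continuous and trivial on `U(J₁)(F)`
    have h := norm_eq_one_of_forall_range_eq_one ((toAdelic F E c 1 J₁).range) (ĉ.comp (adelicInr F E c N 1 JV J₁))
      (Units.continuous_val.comp (hĉc'.comp (continuous_adelicInr F E c N 1 JV J₁))) (by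
        rintro _ ⟨γ, rfl⟩
        exact hĉrat _ (adelicInr_toAdelic_mem_range F E c N 1 JV J₁ γ)) (finAdelicToAdelic F E c 1 J₁ b)
    simpa [htw, twistCharW_apply] using h
  -- the combined weight `ψ := tw · χ_f`, read on `E¹(𝔸_f)` through `u ↦ u·1₁`
  let ψ : finAdelic F E c 1 J₁ →* ℂˣ := tw * χf
  have hψ_apply : ∀ b, ((ψ b : ℂˣ) : ℂ) = ((tw b : ℂˣ) : ℂ) * ((χf b : ℂˣ) : ℂ) := fun b => by
    simp only [ψ, MonoidHom.mul_apply, Units.val_mul]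
  have hψc : Continuous fun b => ((ψ b : ℂˣ) : ℂ) := by
    simp only [hψ_apply]
    exact htwc.mul hχf
  have hψu : ∀ b, ‖((ψ b : ℂˣ) : ℂ)‖ = 1 := fun b => by rw [hψ_apply, norm_mul, htwu, hχfu, mul_one]
  let χ₁ : finAdelicOne F E c →* ℂˣ := ψ.comp (finAdelicCenter F E c 1 J₁)
  have hχ₁ : Continuous χ₁ := by
    refine Units.continuous_iff.2 ⟨hψc.comp (continuous_finAdelicCenter F E c 1 J₁), ?_⟩
    have hinv : Continuous fun b => (((ψ b)⁻¹ : ℂˣ) : ℂ) := by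
      have : (fun b => (((ψ b)⁻¹ : ℂˣ) : ℂ)) = fun b => conj ((ψ b : ℂˣ) : ℂ) := by
        funext b
        rw [Units.val_inv_eq_inv_val]
        exact Complex.inv_eq_conj (hψu b)
      rw [this]
      exact Complex.continuous_conj.comp hψc
    exact hinv.comp (continuous_finAdelicCenter F E c 1 J₁)
  have hχ₁u : ∀ x, ‖((χ₁ x : ℂˣ) : ℂ)‖ = 1 := fun x => hψu _
  have hχ₁_apply : ∀ b, χ₁ (finAdelicCenterInv F E c J₁ hJ₁ b) = ψ b := fun b => by
    show ψ (finAdelicCenter F E c 1 J₁ (finAdelicCenterInv F E c J₁ hJ₁ b)) = ψ b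
    rw [finAdelicCenter_finAdelicCenterInv]
  -- the (FIN) capstone for the reference family `𝓢` and the weight `conj ∘ χ₁ ∘ det`
  obtain ⟨Φ, hΦ⟩ := exists_finCoeff_ne_zero_of_localSplittings F E c N e JV J₁ hJ₁ hcδ hδ hd Tb hTb hJb 𝓢 hTd h3 hJ₁c hχ₁ hχ₁u μ' hL2 μ
    μf νW S₀ hi₀ hB1
  refine ⟨piProdSB F (Fin n) Φ, ?_⟩
  -- the two `b`-integrands agree: `R_e ω_f^{s}(1,b) R_e⁻¹ = (tw b)⁻¹ • Ω(1 ⊗ b)` and `(tw b)⁻¹ · conj (χ_f b) = conj (ψ b)`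
  have hrep : ∀ (b : finAdelic F E c 1 J₁) (Φf : FinSB F (Fin n)),
      finSBReindex F e (finPairRep F E c N 1 e JV J₁ hcδ hδ hd hV hW hVd hWd hJV hJW hs (1, b) ((finSBReindex F e).symm Φf)) =
        (((tw b)⁻¹ : ℂˣ) : ℂ) • 𝓢.Omega (finPairEmb F E c N 1 e JV J₁ (1, b)) Φf := fun b Φf => by
    have htwist := finPairRep_twist F E c N 1 e JV J₁ hcδ hδ hd hV hW hVd hWd hJV hJW ĉ hs hsref (1, b) ((finSBReindex F e).symm Φf)
    rw [href, LinearEquiv.apply_symm_apply, map_one, one_mul] at htwist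
    -- `htwist : R_e⁻¹ (Ω_b Φf) = tw b • ω_f^{s}(1,b) (R_e⁻¹ Φf)`
    have h2 : finPairRep F E c N 1 e JV J₁ hcδ hδ hd hV hW hVd hWd hJV hJW hs (1, b) ((finSBReindex F e).symm Φf) =
        (((tw b)⁻¹ : ℂˣ) : ℂ) • (finSBReindex F e).symm (𝓢.Omega (finPairEmb F E c N 1 e JV J₁ (1, b)) Φf) := by
      rw [htwist, smul_smul, Units.val_inv_eq_inv_val, ← htw, inv_mul_cancel₀ (Units.ne_zero _), one_smul]
    rw [h2, LinearEquiv.map_smul, LinearEquiv.apply_symm_apply]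
  have hint : ∀ b : finAdelic F E c 1 J₁,
      (∫ y, ((finSBReindex F e (finPairRep F E c N 1 e JV J₁ hcδ hδ hd hV hW hVd hWd hJV hJW hs (1, b)
              ((finSBReindex F e).symm (piProdSB F (Fin n) Φ))) : ↥(SchwartzBruhat (Fin n → FiniteAdeleRing (𝓞 F) F))) :
              (Fin n → FiniteAdeleRing (𝓞 F) F) → ℂ) y *
          conj (((piProdSB F (Fin n) Φ : ↥(SchwartzBruhat (Fin n → FiniteAdeleRing (𝓞 F) F))) :
            (Fin n → FiniteAdeleRing (𝓞 F) F) → ℂ) y) ∂μ) * conj (((χf b : ℂˣ) : ℂ)) =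
      (∫ y, ((𝓢.Omega (finPairEmb F E c N 1 e JV J₁ (1, b)) (piProdSB F (Fin n) Φ) :
            ↥(SchwartzBruhat (Fin n → FiniteAdeleRing (𝓞 F) F))) : (Fin n → FiniteAdeleRing (𝓞 F) F) → ℂ) y *
          conj (((piProdSB F (Fin n) Φ : ↥(SchwartzBruhat (Fin n → FiniteAdeleRing (𝓞 F) F))) :
            (Fin n → FiniteAdeleRing (𝓞 F) F) → ℂ) y) ∂μ) *
        conj (((χ₁ (finAdelicCenterInv F E c J₁ hJ₁ b) : ℂˣ) : ℂ)) := fun b => by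
    rw [hrep, hχ₁_apply, hψ_apply, map_mul]
    simp only [Submodule.coe_smul, Pi.smul_apply, smul_eq_mul]
    simp_rw [mul_assoc]
    rw [integral_const_mul]
    -- `(tw b)⁻¹ = conj (tw b)` on the unit circle
    rw [Units.val_inv_eq_inv_val, Complex.inv_eq_conj (htwu b)]
    ring
  simp_rw [hint]
  exact hΦ

end AtSplitting

end Summit.HodgeConjecture.HodgeConjecture.Cruxes.H413.ThetaNonvanishing

end
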